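/-
Copyright (c) 2026 the pub-hodgecm-mathlib formalisation cell (harness21).  Prover seat hodgecm-mathlib-K2E5-p12 (g2), HCML Track B «K2-LIT», h413 =
`stmt-HodgeConjecture-24833`, line `K2_E3_EllipticInputs`, unit U3b, sub-line (ii♭-H) «RANK-ONE CAYLEY ROAD»: THE PAYER of (Ψ-package₂¹)
`sig_K2E3RankOneUnipotentScalingPackageOne` (K2E4-p18 (g3) cand sha16 f5ed4c10d6a09458).  2026-09-04.
-/
import Summits.HodgeConjecture.HodgeConjecture.Theorems.K2E3CayleyScalingRankOneStable           -- ★ (α) p856324 (this seat): (U2st)(Est)(I)(Sst); brings ★ (SC₂) chain p856070–p856261, ★ p855742∕p855813∕p855890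
import Summits.HodgeConjecture.HodgeConjecture.Theorems.K2E3CayleyScalingRankOneProductSmooth    -- ★ (β) p856344 (this seat): (S_H)
import Summits.HodgeConjecture.HodgeConjecture.Theorems.K2E3CayleyScalingRankOneRay              -- ★ (γ) (this seat): (RAY¹) ⟸ (T2-EX), (T2-CPT)
import Summits.HodgeConjecture.HodgeConjecture.Theorems.K2E3NonsplitPlaceNonSquareScalar         -- ★ p856386∕p856408 (K2E3-p06 (g3)): (T2-EX) `exists_galAdicCompletionMap_eq_and_ne_zero_and_not_isSquare`
import Summits.HodgeConjecture.HodgeConjecture.Theorems.K2E3RankOneEllipticCentralizerCompact    -- ★ p856452 (K2E4-p18 (g3)): (T2-CPT) `compactSpace_centralizer_of_irreducible_charpoly`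
import HarnessLib

/-!
# h413 ∕ K2-LIT, line `K2_E3_EllipticInputs`, unit U3b, (ii♭-H): (Ψ-package₂¹) HOLDS — THE RANK-ONE EQUIVARIANT CONTRACTION AT THE IDENTITY OF `U(Φ₂)_v`
# SCALING THE UNIPOTENT ORBITAL INTEGRALS, WITH STABLE-CONJUGACY CLAUSES AND TYPE-(2) RAYS FOR EVERY CENTRAL TRANSLATE

Cell `pub/hodgecm-mathlib`, crux H413 = `stmt-HodgeConjecture-24833`; letter (Ψ-package₂¹) = K2E4-p18 (g3)'s cand
`K2/K2E4-p18/g3/sig_K2E3RankOneUnipotentScalingPackageOne.cand.K2E4-p18-g3.lean` (sha16 f5ed4c10d6a09458), consumed BY NAME by ★ p856384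
`K2E3RankOneUnipotentScalingPackageOfIdentity` ((Ψ-package₂¹) → (Ψ-package₂⁺) e65356ad, hosted U3b ED. 7 Core :261) and then ★ p856124 ((Ψ-package₂⁺) → (Ψ-package♮)).
THEOREMS ONLY (no `def`, no `instance`, no `notation`, no named-fact hypothesis, no `sorry`); lane `--supports stmt-HodgeConjecture-24833 --as helper`.

`rankOneUnipotentScalingPackageOne` : the letter's statement TOKEN FOR TOKEN.  PROOF = the construction of ★ p855890 (`Ψ := e⁻¹ ∘ Ψ₀ ∘ e`, `U₀ := e⁻¹(B)` with
`Ψ₀` the Cayley scaling by `s` on the eigenvalue ball `B` of radius `ρ` in the one-place model, ★ `exists_cayleyScaling`; `Θ` the `s⁻¹`-scaling on the `‖s‖ρ`-ball `B′`),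
with the witnesses `(w, s, ρ, q, a)` and the SCALING LAW (SC₁) taken from ★ `scalingLaw_local_two` (p856229), and the clauses: (U1)(U2)(E)(Z)(C) verbatim as in ★
p855890 (★ `one_mem_ball_nhds`, `conj_mem_ball_iff`, `cayleyScaling_conj_mem`, `centralizer_cayleyScaling_eq`, `cayleyScaling_mem_of_ball`); (U2st)(Est)(I)(Sst) = ★ (α);
(S_H) = ★ (β); (Q) from the law; (RAY¹) = ★ (γ) fed with ★ (T2-EX) (K2E3-p06 (g3)) and ★ (T2-CPT) (K2E4-p18 (g3)); the place hypothesis `Subsingleton (PlacesOver L v)`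
gives `c • w = w` (★ `PlacesOver` is a singleton at a non-split place).

HONEST LABEL.  HC_CM is proved only modulo the 7 printed citations (2 remaining named inputs: hLiu418 = `stmt-HodgeConjecture-24832`, h413 =
`stmt-HodgeConjecture-24833`) until rung 0 closes.  With this file (Ψ-package₂¹) is ★ OUTRIGHT, hence (via ★ p856384 ∘ ★ p856124) the (Ψ-package♮) input of (HOM-ray*♮)
(★ p855910) rests on ★ files only; count-neutral helper until the dealer ties the socket.

## References
* [Rogawski1990] J. D. Rogawski, *Automorphic Representations of Unitary Groups in Three Variables* (1990), §8.1 Props. 8.1.1–8.1.2 pp. 112–114; (8.1.1) p. 116; §3.1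
  p. 19; §3.5 Prop. 3.5.2 (c) pp. 25–26; §3.6 p. 28; §4.3 p. 42.
* [HarishChandra1999AdmissibleDistributions] Harish-Chandra, *Admissible Invariant Distributions on Reductive p-adic Groups*, ULS 16 (1999), §3.1 Lemma 3.2; Thm. 8.1 (1) p. 48.
* [PlatonovRapinchuk1994] V. Platonov, A. Rapinchuk, *Algebraic Groups and Number Theory* (1994), §3.3, §5.1, §6.4.
-/

set_option autoImplicit false
set_option linter.dupNamespace false  -- the mandated namespace repeats the single-problem summit's segment (`HodgeConjecture.HodgeConjecture`)

noncomputable section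

open NumberField IsDedekindDomain MeasureTheory Filter Topology Set
open scoped Matrix MatrixGroups
open Literature.NumberTheory.Rogawski1990 Literature.NumberTheory.Automorphic Literature.NumberTheory.Automorphic.UnitaryGroup
open Literature.NumberTheory.Weil1982.UnitaryFinTopForm
open Summit.HodgeConjecture.HodgeConjecture.Cruxes.H413.K2E3CayleyScalingRankOne Summit.HodgeConjecture.HodgeConjecture.Cruxes.H413.K2E3CayleyScalingRankOneMap
open Summit.HodgeConjecture.HodgeConjecture.Cruxes.H413.K2E3CayleyScalingLawRankOne (scalingLaw_local_two)
open Summit.HodgeConjecture.HodgeConjecture.Cruxes.H413.K2E3CayleyScalingRankOneStable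
open Summit.HodgeConjecture.HodgeConjecture.Cruxes.H413.K2E3CayleyScalingRankOneProductSmooth (isLocSmooth_indicator_prod_comp_local)
open Summit.HodgeConjecture.HodgeConjecture.Cruxes.H413.K2E3CayleyScalingRankOneRay (exists_ray_of_nonsquare_of_compact)
open Summit.HodgeConjecture.HodgeConjecture.Cruxes.H413.K2E3NonsplitPlaceNonSquareScalar (exists_galAdicCompletionMap_eq_and_ne_zero_and_not_isSquare)
open Summit.HodgeConjecture.HodgeConjecture.Cruxes.H413.K2E3RankOneEllipticCentralizerCompact (compactSpace_centralizer_of_irreducible_charpoly)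

namespace Summit.HodgeConjecture.HodgeConjecture.Cruxes.H413.K2E3RankOneUnipotentScalingPackageOne

set_option maxHeartbeats 4000000 in  -- one `whnf`-heavy conversion «local» carrier ↦ `cmDatum` carrier (cf. ★ p855890 `psiPackage_of_scalingLaw_two`)
/-- ‹SC₂-explicit› on the `cmDatum` carrier (the `hSC` binder of ★ p855890 `psiPackage_of_scalingLaw_two`, token for token) — ★ `scalingLaw_local_two` (p856229) read through
★ `cmDatum_Local` (`rfl`). [cite: HarishChandra1999AdmissibleDistributions, §3.1 Lemma 3.2] [cite: Rogawski1990, §8.1 Prop. 8.1.2 (b) p. 114] -/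
theorem scalingLaw_two :
    ∀ (L : Type) [Field L] [NumberField L] [IsCMField L] (v : HeightOneSpectrum (𝓞 ↥(maximalRealSubfield L))),
      (∀ w : PlacesOver L v, IsCMField.complexConj L • w.1 = w.1) →
      ∀ [MeasurableSpace ((UnitaryGroup.cmDatum L 2 (Matrix.of fun i j : Fin 2 => if i.val + j.val + 1 = 2 then (1 : L) else 0)).Local v)]
        [BorelSpace ((UnitaryGroup.cmDatum L 2 (Matrix.of fun i j : Fin 2 => if i.val + j.val + 1 = 2 then (1 : L) else 0)).Local v)]
        [∀ γ : (UnitaryGroup.cmDatum L 2 (Matrix.of fun i j : Fin 2 => if i.val + j.val + 1 = 2 then (1 : L) else 0)).Local v,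
          MeasurableSpace ((UnitaryGroup.cmDatum L 2 (Matrix.of fun i j : Fin 2 => if i.val + j.val + 1 = 2 then (1 : L) else 0)).Local v ⧸
            Subgroup.centralizer ({γ} : Set ((UnitaryGroup.cmDatum L 2 (Matrix.of fun i j : Fin 2 => if i.val + j.val + 1 = 2 then (1 : L) else 0)).Local v)))]
        [∀ γ : (UnitaryGroup.cmDatum L 2 (Matrix.of fun i j : Fin 2 => if i.val + j.val + 1 = 2 then (1 : L) else 0)).Local v,
          BorelSpace ((UnitaryGroup.cmDatum L 2 (Matrix.of fun i j : Fin 2 => if i.val + j.val + 1 = 2 then (1 : L) else 0)).Local v ⧸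
            Subgroup.centralizer ({γ} : Set ((UnitaryGroup.cmDatum L 2 (Matrix.of fun i j : Fin 2 => if i.val + j.val + 1 = 2 then (1 : L) else 0)).Local v)))],
      ∃ (w : PlacesOver L v) (hw : IsCMField.complexConj L • w.1 = w.1) (s : w.1.adicCompletion L) (ρ : ℝ) (q : ℂ)
        (a : ConjClasses ((UnitaryGroup.cmDatum L 2 (Matrix.of fun i j : Fin 2 => if i.val + j.val + 1 = 2 then (1 : L) else 0)).Local v) → ℕ),
        galAdicCompletionMap (L := L) (IsCMField.complexConj L) hw s = s ∧ s ≠ 0 ∧ ‖s‖ < 1 ∧ 0 < ρ ∧ ρ < 1 ∧ 1 < ‖q‖ ∧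
        (∀ u : ConjClasses ((UnitaryGroup.cmDatum L 2 (Matrix.of fun i j : Fin 2 => if i.val + j.val + 1 = 2 then (1 : L) else 0)).Local v), u ≠ ConjClasses.mk 1 → 1 ≤ a u) ∧
        ∀ (Ψ : (UnitaryGroup.cmDatum L 2 (Matrix.of fun i j : Fin 2 => if i.val + j.val + 1 = 2 then (1 : L) else 0)).Local v →
            (UnitaryGroup.cmDatum L 2 (Matrix.of fun i j : Fin 2 => if i.val + j.val + 1 = 2 then (1 : L) else 0)).Local v)
          (U₀ : Set ((UnitaryGroup.cmDatum L 2 (Matrix.of fun i j : Fin 2 => if i.val + j.val + 1 = 2 then (1 : L) else 0)).Local v)),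
          (∀ γ : (UnitaryGroup.cmDatum L 2 (Matrix.of fun i j : Fin 2 => if i.val + j.val + 1 = 2 then (1 : L) else 0)).Local v, γ ∈ U₀ ↔
            IsUnit ((((localNonsplitEquiv (IsCMField.complexConj L) (Matrix.of fun i j : Fin 2 => if i.val + j.val + 1 = 2 then (1 : L) else 0) (IsCMField.complexConj_ne_one L) w hw γ :
                ↥(unitaryGroupOfForm (galAdicCompletionMap (L := L) (IsCMField.complexConj L) hw) (placeForm (Matrix.of fun i j : Fin 2 => if i.val + j.val + 1 = 2 then (1 : L) else 0) w.1))) :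
                  GL (Fin 2) (w.1.adicCompletion L)) : Matrix (Fin 2) (Fin 2) (w.1.adicCompletion L)) + 1).det ∧
            ‖(((((localNonsplitEquiv (IsCMField.complexConj L) (Matrix.of fun i j : Fin 2 => if i.val + j.val + 1 = 2 then (1 : L) else 0) (IsCMField.complexConj_ne_one L) w hw γ :
                ↥(unitaryGroupOfForm (galAdicCompletionMap (L := L) (IsCMField.complexConj L) hw) (placeForm (Matrix.of fun i j : Fin 2 => if i.val + j.val + 1 = 2 then (1 : L) else 0) w.1))) :
                  GL (Fin 2) (w.1.adicCompletion L)) : Matrix (Fin 2) (Fin 2) (w.1.adicCompletion L)) - 1) *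
                ((((localNonsplitEquiv (IsCMField.complexConj L) (Matrix.of fun i j : Fin 2 => if i.val + j.val + 1 = 2 then (1 : L) else 0) (IsCMField.complexConj_ne_one L) w hw γ :
                ↥(unitaryGroupOfForm (galAdicCompletionMap (L := L) (IsCMField.complexConj L) hw) (placeForm (Matrix.of fun i j : Fin 2 => if i.val + j.val + 1 = 2 then (1 : L) else 0) w.1))) :
                  GL (Fin 2) (w.1.adicCompletion L)) : Matrix (Fin 2) (Fin 2) (w.1.adicCompletion L)) + 1)⁻¹).trace‖ ≤ ρ ∧
            ‖(((((localNonsplitEquiv (IsCMField.complexConj L) (Matrix.of fun i j : Fin 2 => if i.val + j.val + 1 = 2 then (1 : L) else 0) (IsCMField.complexConj_ne_one L) w hw γ :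
                ↥(unitaryGroupOfForm (galAdicCompletionMap (L := L) (IsCMField.complexConj L) hw) (placeForm (Matrix.of fun i j : Fin 2 => if i.val + j.val + 1 = 2 then (1 : L) else 0) w.1))) :
                  GL (Fin 2) (w.1.adicCompletion L)) : Matrix (Fin 2) (Fin 2) (w.1.adicCompletion L)) - 1) *
                ((((localNonsplitEquiv (IsCMField.complexConj L) (Matrix.of fun i j : Fin 2 => if i.val + j.val + 1 = 2 then (1 : L) else 0) (IsCMField.complexConj_ne_one L) w hw γ :
                ↥(unitaryGroupOfForm (galAdicCompletionMap (L := L) (IsCMField.complexConj L) hw) (placeForm (Matrix.of fun i j : Fin 2 => if i.val + j.val + 1 = 2 then (1 : L) else 0) w.1))) :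
                  GL (Fin 2) (w.1.adicCompletion L)) : Matrix (Fin 2) (Fin 2) (w.1.adicCompletion L)) + 1)⁻¹).det‖ ≤ ρ ^ 2) →
          (∀ γ ∈ U₀,
            (((localNonsplitEquiv (IsCMField.complexConj L) (Matrix.of fun i j : Fin 2 => if i.val + j.val + 1 = 2 then (1 : L) else 0) (IsCMField.complexConj_ne_one L) w hw (Ψ γ) :
                ↥(unitaryGroupOfForm (galAdicCompletionMap (L := L) (IsCMField.complexConj L) hw) (placeForm (Matrix.of fun i j : Fin 2 => if i.val + j.val + 1 = 2 then (1 : L) else 0) w.1))) :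
                  GL (Fin 2) (w.1.adicCompletion L)) : Matrix (Fin 2) (Fin 2) (w.1.adicCompletion L)) =
              cayley (s • (((((localNonsplitEquiv (IsCMField.complexConj L) (Matrix.of fun i j : Fin 2 => if i.val + j.val + 1 = 2 then (1 : L) else 0) (IsCMField.complexConj_ne_one L) w hw γ :
                ↥(unitaryGroupOfForm (galAdicCompletionMap (L := L) (IsCMField.complexConj L) hw) (placeForm (Matrix.of fun i j : Fin 2 => if i.val + j.val + 1 = 2 then (1 : L) else 0) w.1))) :
                  GL (Fin 2) (w.1.adicCompletion L)) : Matrix (Fin 2) (Fin 2) (w.1.adicCompletion L)) - 1) *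
                ((((localNonsplitEquiv (IsCMField.complexConj L) (Matrix.of fun i j : Fin 2 => if i.val + j.val + 1 = 2 then (1 : L) else 0) (IsCMField.complexConj_ne_one L) w hw γ :
                ↥(unitaryGroupOfForm (galAdicCompletionMap (L := L) (IsCMField.complexConj L) hw) (placeForm (Matrix.of fun i j : Fin 2 => if i.val + j.val + 1 = 2 then (1 : L) else 0) w.1))) :
                  GL (Fin 2) (w.1.adicCompletion L)) : Matrix (Fin 2) (Fin 2) (w.1.adicCompletion L)) + 1)⁻¹))) →
          ∀ (S : Finset (ConjClasses ((UnitaryGroup.cmDatum L 2 (Matrix.of fun i j : Fin 2 => if i.val + j.val + 1 = 2 then (1 : L) else 0)).Local v)))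
            (mU : OrbitalMeasureFamily ((UnitaryGroup.cmDatum L 2 (Matrix.of fun i j : Fin 2 => if i.val + j.val + 1 = 2 then (1 : L) else 0)).Local v)),
            (∀ u ∈ S, (((Quotient.out u : (UnitaryGroup.cmDatum L 2 (Matrix.of fun i j : Fin 2 => if i.val + j.val + 1 = 2 then (1 : L) else 0)).Local v).val :
                GL (Fin 2) (UnitaryGroup.LocalRing L v)).val - 1) ^ 2 = 0) →
            mU.IsAdmissibleOn (fun γ : (UnitaryGroup.cmDatum L 2 (Matrix.of fun i j : Fin 2 => if i.val + j.val + 1 = 2 then (1 : L) else 0)).Local v => (ConjClasses.mk γ) ∈ S) →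
            ∀ u ∈ S, ∀ F : (UnitaryGroup.cmDatum L 2 (Matrix.of fun i j : Fin 2 => if i.val + j.val + 1 = 2 then (1 : L) else 0)).Local v → ℂ, IsLocSmooth F →
              classOrbitalIntegral mU (U₀.indicator (F ∘ Ψ)) u = q ^ (a u) * classOrbitalIntegral mU F u :=
  scalingLaw_local_two

set_option maxHeartbeats 4000000 in  -- statement-level `whnf` on the CM carriers (the letter is typed on `(cmDatum …).Local v`, the law ★ p856229 on `↥(«local» …)`)
/-- **(Ψ-package₂¹) — RANK-ONE EQUIVARIANT CONTRACTION AT THE IDENTITY OF `U(Φ₂)_v` SCALING THE UNIPOTENT ORBITAL INTEGRALS, WITH STABLE-CONJUGACY CLAUSES AND TYPE-(2)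
RAYS FOR EVERY CENTRAL TRANSLATE** (K2E4-p18 (g3)'s letter, sha16 f5ed4c10d6a09458, TOKEN FOR TOKEN).  See the module docstring.
[cite: Rogawski1990, §8.1 Props. 8.1.1–8.1.2 pp. 112–114; §3.5 Prop. 3.5.2 (c) pp. 25–26; §3.6 p. 28] [cite: HarishChandra1999AdmissibleDistributions, §3.1 Lemma 3.2; Thm. 8.1 (1) p. 48] -/
theorem rankOneUnipotentScalingPackageOne :
    ∀ (L : Type) [Field L] [NumberField L] [IsCMField L] (v : HeightOneSpectrum (𝓞 ↥(maximalRealSubfield L)))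
      [MeasurableSpace ((UnitaryGroup.cmDatum L 2 (Matrix.of fun i j : Fin 2 => if i.val + j.val + 1 = 2 then (1 : L) else 0)).Local v)] [BorelSpace ((UnitaryGroup.cmDatum L 2 (Matrix.of fun i j : Fin 2 => if i.val + j.val + 1 = 2 then (1 : L) else 0)).Local v)]
      [∀ γ : (UnitaryGroup.cmDatum L 2 (Matrix.of fun i j : Fin 2 => if i.val + j.val + 1 = 2 then (1 : L) else 0)).Local v, MeasurableSpace ((UnitaryGroup.cmDatum L 2 (Matrix.of fun i j : Fin 2 => if i.val + j.val + 1 = 2 then (1 : L) else 0)).Local v ⧸ Subgroup.centralizer ({γ} : Set ((UnitaryGroup.cmDatum L 2 (Matrix.of fun i j : Fin 2 => if i.val + j.val + 1 = 2 then (1 : L) else 0)).Local v)))]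
      [∀ γ : (UnitaryGroup.cmDatum L 2 (Matrix.of fun i j : Fin 2 => if i.val + j.val + 1 = 2 then (1 : L) else 0)).Local v, BorelSpace ((UnitaryGroup.cmDatum L 2 (Matrix.of fun i j : Fin 2 => if i.val + j.val + 1 = 2 then (1 : L) else 0)).Local v ⧸ Subgroup.centralizer ({γ} : Set ((UnitaryGroup.cmDatum L 2 (Matrix.of fun i j : Fin 2 => if i.val + j.val + 1 = 2 then (1 : L) else 0)).Local v)))],
      Subsingleton (UnitaryGroup.PlacesOver L v) →
    ∃ (Ψ : (UnitaryGroup.cmDatum L 2 (Matrix.of fun i j : Fin 2 => if i.val + j.val + 1 = 2 then (1 : L) else 0)).Local v → (UnitaryGroup.cmDatum L 2 (Matrix.of fun i j : Fin 2 => if i.val + j.val + 1 = 2 then (1 : L) else 0)).Local v) (U₀ : Set ((UnitaryGroup.cmDatum L 2 (Matrix.of fun i j : Fin 2 => if i.val + j.val + 1 = 2 then (1 : L) else 0)).Local v)) (q : ℂ) (a : ConjClasses ((UnitaryGroup.cmDatum L 2 (Matrix.of fun i j : Fin 2 => if i.val + j.val + 1 = 2 then (1 : L) else 0)).Local v) →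 ℕ),
      U₀ ∈ 𝓝 (1 : (UnitaryGroup.cmDatum L 2 (Matrix.of fun i j : Fin 2 => if i.val + j.val + 1 = 2 then (1 : L) else 0)).Local v) ∧
      (∀ γ ∈ U₀, ∀ x : (UnitaryGroup.cmDatum L 2 (Matrix.of fun i j : Fin 2 => if i.val + j.val + 1 = 2 then (1 : L) else 0)).Local v, x * γ * x⁻¹ ∈ U₀) ∧
      (∀ γ ∈ U₀, ∀ δ : (UnitaryGroup.cmDatum L 2 (Matrix.of fun i j : Fin 2 => if i.val + j.val + 1 = 2 then (1 : L) else 0)).Local v, IsLocalStablyConjH L v (γ, (1 : (UnitaryGroup.cmDatum L 1 (Matrix.of fun i j : Fin 1 => if i.val + j.val + 1 = 1 then (1 : L) else 0)).Local v)) (δ, (1 : (UnitaryGroup.cmDatum L 1 (Matrix.of fun i j : Fin 1 => if i.val + j.val + 1 = 1 then (1 : L) else 0)).Local v)) → δ ∈ U₀) ∧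
      (∀ γ ∈ U₀, ∀ x : (UnitaryGroup.cmDatum L 2 (Matrix.of fun i j : Fin 2 => if i.val + j.val + 1 = 2 then (1 : L) else 0)).Local v, Ψ (x * γ * x⁻¹) = x * Ψ γ * x⁻¹) ∧
      (∀ γ ∈ U₀, ∀ y : (UnitaryGroup.cmDatum L 2 (Matrix.of fun i j : Fin 2 => if i.val + j.val + 1 = 2 then (1 : L) else 0)).Local v, y * γ = γ * y ↔ y * Ψ γ = Ψ γ * y) ∧
      (∀ γ ∈ U₀, ∀ δ ∈ U₀, IsLocalStablyConjH L v (γ, (1 : (UnitaryGroup.cmDatum L 1 (Matrix.of fun i j : Fin 1 => if i.val + j.val + 1 = 1 then (1 : L) else 0)).Local v)) (δ, (1 : (UnitaryGroup.cmDatum L 1 (Matrix.of fun i j : Fin 1 => if i.val + j.val + 1 = 1 then (1 : L) else 0)).Local v)) → IsLocalStablyConjH L v (Ψ γ, (1 : (UnitaryGroup.cmDatum L 1 (Matrix.of fun i j : Fin 1 => if i.val + j.val + 1 = 1 then (1 : L) else 0)).Local v)) (Ψ δ, (1 : (UnitaryGroup.cmDatum L 1 (Matrix.of fun i j : Fin 1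 => if i.val + j.val + 1 = 1 then (1 : L) else 0)).Local v))) ∧
      (∀ γ ∈ U₀, ∀ δ ∈ U₀, Ψ γ = Ψ δ → γ = δ) ∧
      (∀ γ ∈ U₀, ∀ η : (UnitaryGroup.cmDatum L 2 (Matrix.of fun i j : Fin 2 => if i.val + j.val + 1 = 2 then (1 : L) else 0)).Local v, IsLocalStablyConjH L v (Ψ γ, (1 : (UnitaryGroup.cmDatum L 1 (Matrix.of fun i j : Fin 1 => if i.val + j.val + 1 = 1 then (1 : L) else 0)).Local v)) (η, (1 : (UnitaryGroup.cmDatum L 1 (Matrix.of fun i j : Fin 1 => if i.val + j.val + 1 = 1 then (1 : L) else 0)).Local v)) → ∃ δ ∈ U₀, IsLocalStablyConjH L v (γ, (1 : (UnitaryGroup.cmDatum L 1 (Matrix.of fun i j : Fin 1 => if i.val + j.val + 1 = 1 then (1 : L) else 0)).Local v)) (δ, (1 : (UnitaryGroup.cmDatum L 1 (Matrix.of fun i j : Fin 1 => if i.val + j.val + 1 = 1 then (1 : L) else 0)).Local v)) ∧ Ψ δ = η) ∧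
      (∀ γ ∈ U₀, Ψ γ ∈ U₀) ∧
      (∀ F : (UnitaryGroup.cmDatum L 2 (Matrix.of fun i j : Fin 2 => if i.val + j.val + 1 = 2 then (1 : L) else 0)).Local v × (UnitaryGroup.cmDatum L 1 (Matrix.of fun i j : Fin 1 => if i.val + j.val + 1 = 1 then (1 : L) else 0)).Local v → ℂ, IsLocSmooth F →
        IsLocSmooth ((U₀ ×ˢ (Set.univ : Set ((UnitaryGroup.cmDatum L 1 (Matrix.of fun i j : Fin 1 => if i.val + j.val + 1 = 1 then (1 : L) else 0)).Local v))).indicator (F ∘ fun γ : (UnitaryGroup.cmDatum L 2 (Matrix.of fun i j : Fin 2 => if i.val + j.val + 1 = 2 then (1 : L) else 0)).Local v × (UnitaryGroup.cmDatum L 1 (Matrix.of fun i j : Fin 1 => if i.val + j.val + 1 = 1 then (1 : L) else 0)).Local v => (Ψ γ.1, γ.2)))) ∧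
      1 < ‖q‖ ∧
      (∀ u : ConjClasses ((UnitaryGroup.cmDatum L 2 (Matrix.of fun i j : Fin 2 => if i.val + j.val + 1 = 2 then (1 : L) else 0)).Local v), u ≠ ConjClasses.mk 1 → 1 ≤ a u) ∧
      (∀ ζ : (UnitaryGroup.cmDatum L 2 (Matrix.of fun i j : Fin 2 => if i.val + j.val + 1 = 2 then (1 : L) else 0)).Local v, ζ ∈ Subgroup.center ((UnitaryGroup.cmDatum L 2 (Matrix.of fun i j : Fin 2 => if i.val + j.val + 1 = 2 then (1 : L) else 0)).Local v) → ∀ lam : (UnitaryGroup.cmDatum L 1 (Matrix.of fun i j : Fin 1 => if i.val + j.val + 1 = 1 then (1 : L) else 0)).Local v, ∃ t : (UnitaryGroup.cmDatum L 2 (Matrix.of fun i j : Fin 2 => if i.val + j.val + 1 = 2 then (1 : L) else 0)).Local v, t ∈ U₀ ∧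
        (∀ k : ℕ, IsLocalGRegular L v (Ψ^[k] t * ζ, lam)) ∧
        (∀ k : ℕ, CompactSpace (Subgroup.centralizer ({Ψ^[k] t} : Set ((UnitaryGroup.cmDatum L 2 (Matrix.of fun i j : Fin 2 => if i.val + j.val + 1 = 2 then (1 : L) else 0)).Local v)))) ∧
        (∀ k : ℕ, Irreducible (((Ψ^[k] t * ζ : (UnitaryGroup.cmDatum L 2 (Matrix.of fun i j : Fin 2 => if i.val + j.val + 1 = 2 then (1 : L) else 0)).Local v).val : GL (Fin 2) (UnitaryGroup.LocalRing L v)).val.charpoly)) ∧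
        Tendsto (fun k : ℕ => Ψ^[k] t) atTop (𝓝 1)) ∧
      ∀ (S₁ : Finset (ConjClasses ((UnitaryGroup.cmDatum L 2 (Matrix.of fun i j : Fin 2 => if i.val + j.val + 1 = 2 then (1 : L) else 0)).Local v))) (mU₁ : OrbitalMeasureFamily ((UnitaryGroup.cmDatum L 2 (Matrix.of fun i j : Fin 2 => if i.val + j.val + 1 = 2 then (1 : L) else 0)).Local v)),
        (∀ u ∈ S₁, (((Quotient.out u : (UnitaryGroup.cmDatum L 2 (Matrix.of fun i j : Fin 2 => if i.val + j.val + 1 = 2 then (1 : L) else 0)).Local v).val : GL (Fin 2) (UnitaryGroup.LocalRing L v)).val - 1) ^ 2 = 0) →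
        mU₁.IsAdmissibleOn (fun γ : (UnitaryGroup.cmDatum L 2 (Matrix.of fun i j : Fin 2 => if i.val + j.val + 1 = 2 then (1 : L) else 0)).Local v => ConjClasses.mk γ ∈ S₁) →
        ∀ u ∈ S₁, ∀ G : (UnitaryGroup.cmDatum L 2 (Matrix.of fun i j : Fin 2 => if i.val + j.val + 1 = 2 then (1 : L) else 0)).Local v → ℂ, IsLocSmooth G →
          classOrbitalIntegral mU₁ (U₀.indicator (G ∘ Ψ)) u = q ^ (a u) * classOrbitalIntegral mU₁ G u := by
  intro L _ _ _ v _ _ _ _ hsub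
  classical
  -- ### the place `w`, non-split; the law ★ p856229 supplies `w, hw, s, ρ, q, a`
  have hns : ∀ w : PlacesOver L v, IsCMField.complexConj L • w.1 = w.1 := fun w => by
    have hmem : (IsCMField.complexConj L • w.1).under (𝓞 ↥(maximalRealSubfield L)) = v := by
      rw [HeightOneSpectrum.under_algEquiv_smul]; exact w.2
    exact congrArg Subtype.val (Subsingleton.elim (⟨IsCMField.complexConj L • w.1, hmem⟩ : PlacesOver L v) w)
  obtain ⟨w, hw, s, ρ, q, a, hσs, hs0, hs1, hρ0, hρ1, hq, ha, hlaw⟩ := scalingLaw_two L v hns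
  haveI : CharZero (w.1.adicCompletion L) := charZero_of_injective_algebraMap (algebraMap L (w.1.adicCompletion L)).injective
  have h2 : (2 : w.1.adicCompletion L) ≠ 0 := two_ne_zero
  have hsρ : ‖s‖ * ρ < 1 := lt_of_le_of_lt (mul_le_of_le_one_left hρ0.le hs1.le) hρ1
  have hsρ0 : 0 < ‖s‖ * ρ := mul_pos (norm_pos_iff.2 hs0) hρ0
  have hsρ' : ‖s⁻¹‖ * (‖s‖ * ρ) < 1 := by rwa [norm_inv, ← mul_assoc, inv_mul_cancel₀ (norm_ne_zero_iff.2 hs0), one_mul]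
  have hσs' : galAdicCompletionMap (L := L) (IsCMField.complexConj L) hw s⁻¹ = s⁻¹ := by rw [map_inv₀, hσs]
  -- ### the balls `B ⊇ B′` of radii `ρ`, `‖s‖ρ` in the model and the scalings `Ψ₀` (by `s`), `Θ` (by `s⁻¹`)
  set e := (localNonsplitEquiv (IsCMField.complexConj L) (Matrix.of fun i j : Fin 2 => if i.val + j.val + 1 = 2 then (1 : L) else 0) (IsCMField.complexConj_ne_one L) w hw) with he_def
  have hemul : ∀ x y : (UnitaryGroup.cmDatum L 2 (Matrix.of fun i j : Fin 2 => if i.val + j.val + 1 = 2 then (1 : L) else 0)).Local v, e ((x * y : (UnitaryGroup.cmDatum L 2 (Matrix.of fun i j : Fin 2 => if i.val + j.val + 1 = 2 then (1 : L) else 0)).Local v)) = e x * e y := fun x y => map_mul e x y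
  have heinv : ∀ x : (UnitaryGroup.cmDatum L 2 (Matrix.of fun i j : Fin 2 => if i.val + j.val + 1 = 2 then (1 : L) else 0)).Local v, e ((x⁻¹ : (UnitaryGroup.cmDatum L 2 (Matrix.of fun i j : Fin 2 => if i.val + j.val + 1 = 2 then (1 : L) else 0)).Local v)) = (e x)⁻¹ := fun x => map_inv e x
  have heone : e ((1 : (UnitaryGroup.cmDatum L 2 (Matrix.of fun i j : Fin 2 => if i.val + j.val + 1 = 2 then (1 : L) else 0)).Local v)) = 1 := map_one e
  set B : Set ↥(unitaryGroupOfForm (galAdicCompletionMap (L := L) (IsCMField.complexConj L) hw) (placeForm (Matrix.of fun i j : Fin 2 => if i.val + j.val + 1 = 2 then (1 : L) else 0) w.1)) := {u | IsUnit ((((u : ↥(unitaryGroupOfForm (galAdicCompletionMap (L := L) (IsCMField.complexConj L) hw) (placeForm (Matrix.of fun i j : Fin 2 => if i.val + j.val + 1 = 2 then (1 : L) else 0) w.1))) : GL (Fin 2) (w.1.adicCompletion L)) : Matrix (Fin 2) (Fin 2) (w.1.adicCompletion L)) + 1).det ∧ ‖(((((u : ↥(unitaryGroupOfForm (galAdicCompletionMap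 (L := L) (IsCMField.complexConj L) hw) (placeForm (Matrix.of fun i j : Fin 2 => if i.val + j.val + 1 = 2 then (1 : L) else 0) w.1))) : GL (Fin 2) (w.1.adicCompletion L)) : Matrix (Fin 2) (Fin 2) (w.1.adicCompletion L)) - 1) * ((((u : ↥(unitaryGroupOfForm (galAdicCompletionMap (L := L) (IsCMField.complexConj L) hw) (placeForm (Matrix.of fun i j : Fin 2 => if i.val + j.val + 1 = 2 then (1 : L) else 0) w.1))) : GL (Fin 2) (w.1.adicCompletion L)) : Matrix (Fin 2) (Fin 2) (w.1.adicCompletion L)) + 1)⁻¹).trace‖ ≤ ρ ∧ ‖(((((u : ↥(unitaryGroupOfForm (galAdicCompletionMap (L := L) (IsCMField.complexConj L) hw) (placeForm (Matrix.of fun i j : Fin 2 => if i.val + j.val + 1 = 2 then (1 : L) else 0) w.1))) : GL (Fin 2) (w.1.adicCompletion L)) : Matrix (Fin 2) (Fin 2) (w.1.adicCompletion L)) - 1) * ((((u : ↥(unitaryGroupOfForm (galAdicCompletionMap (L := L) (IsCMField.complexConj L) hw) (placeForm (Matrix.of fun i j : Fin 2 => if i.val + j.val + 1 = 2 then (1 :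 L) else 0) w.1))) : GL (Fin 2) (w.1.adicCompletion L)) : Matrix (Fin 2) (Fin 2) (w.1.adicCompletion L)) + 1)⁻¹).det‖ ≤ ρ ^ 2} with hB_def
  have hB : ∀ u : ↥(unitaryGroupOfForm (galAdicCompletionMap (L := L) (IsCMField.complexConj L) hw) (placeForm (Matrix.of fun i j : Fin 2 => if i.val + j.val + 1 = 2 then (1 : L) else 0) w.1)), u ∈ B ↔ IsUnit ((((u : ↥(unitaryGroupOfForm (galAdicCompletionMap (L := L) (IsCMField.complexConj L) hw) (placeForm (Matrix.of fun i j : Fin 2 => if i.val + j.val + 1 = 2 then (1 : L) else 0) w.1))) : GL (Fin 2) (w.1.adicCompletion L)) : Matrix (Fin 2) (Fin 2) (w.1.adicCompletion L)) + 1).det ∧ ‖(((((u : ↥(unitaryGroupOfForm (galAdicCompletionMap (L := L) (IsCMField.complexConj L) hw) (placeForm (Matrix.of fun i j : Fin 2 => if i.val + j.val + 1 = 2 then (1 : L) else 0) w.1))) : GL (Fin 2) (w.1.adicCompletion L)) : Matrix (Fin 2) (Fin 2) (w.1.adicCompletion L)) - 1) * ((((u : ↥(unitaryGroupOfForm (galAdicCompletionMap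 (L := L) (IsCMField.complexConj L) hw) (placeForm (Matrix.of fun i j : Fin 2 => if i.val + j.val + 1 = 2 then (1 : L) else 0) w.1))) : GL (Fin 2) (w.1.adicCompletion L)) : Matrix (Fin 2) (Fin 2) (w.1.adicCompletion L)) + 1)⁻¹).trace‖ ≤ ρ ∧ ‖(((((u : ↥(unitaryGroupOfForm (galAdicCompletionMap (L := L) (IsCMField.complexConj L) hw) (placeForm (Matrix.of fun i j : Fin 2 => if i.val + j.val + 1 = 2 then (1 : L) else 0) w.1))) : GL (Fin 2) (w.1.adicCompletion L)) : Matrix (Fin 2) (Fin 2) (w.1.adicCompletion L)) - 1) * ((((u : ↥(unitaryGroupOfForm (galAdicCompletionMap (L := L) (IsCMField.complexConj L) hw) (placeForm (Matrix.of fun i j : Fin 2 => if i.val + j.val + 1 = 2 then (1 : L) else 0) w.1))) : GL (Fin 2) (w.1.adicCompletion L)) : Matrix (Fin 2) (Fin 2) (w.1.adicCompletion L)) + 1)⁻¹).det‖ ≤ ρ ^ 2 := fun u => Iff.rfl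
  set B' : Set ↥(unitaryGroupOfForm (galAdicCompletionMap (L := L) (IsCMField.complexConj L) hw) (placeForm (Matrix.of fun i j : Fin 2 => if i.val + j.val + 1 = 2 then (1 : L) else 0) w.1)) := {u | IsUnit ((((u : ↥(unitaryGroupOfForm (galAdicCompletionMap (L := L) (IsCMField.complexConj L) hw) (placeForm (Matrix.of fun i j : Fin 2 => if i.val + j.val + 1 = 2 then (1 : L) else 0) w.1))) : GL (Fin 2) (w.1.adicCompletion L)) : Matrix (Fin 2) (Fin 2) (w.1.adicCompletion L)) + 1).det ∧ ‖(((((u : ↥(unitaryGroupOfForm (galAdicCompletionMap (L := L) (IsCMField.complexConj L) hw) (placeForm (Matrix.of fun i j : Fin 2 => if i.val + j.val + 1 = 2 then (1 : L) else 0) w.1))) : GL (Fin 2) (w.1.adicCompletion L)) : Matrix (Fin 2) (Fin 2) (w.1.adicCompletion L)) - 1) * ((((u : ↥(unitaryGroupOfForm (galAdicCompletionMap (L := L) (IsCMField.complexConj L) hw) (placeForm (Matrix.of fun i j : Fin 2 => if i.val + j.val + 1 = 2 then (1 : L) else 0) w.1))) : GL (Fin 2) (w.1.adicCompletion L)) :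 Matrix (Fin 2) (Fin 2) (w.1.adicCompletion L)) + 1)⁻¹).trace‖ ≤ ‖s‖ * ρ ∧ ‖(((((u : ↥(unitaryGroupOfForm (galAdicCompletionMap (L := L) (IsCMField.complexConj L) hw) (placeForm (Matrix.of fun i j : Fin 2 => if i.val + j.val + 1 = 2 then (1 : L) else 0) w.1))) : GL (Fin 2) (w.1.adicCompletion L)) : Matrix (Fin 2) (Fin 2) (w.1.adicCompletion L)) - 1) * ((((u : ↥(unitaryGroupOfForm (galAdicCompletionMap (L := L) (IsCMField.complexConj L) hw) (placeForm (Matrix.of fun i j : Fin 2 => if i.val + j.val + 1 = 2 then (1 : L) else 0) w.1))) : GL (Fin 2) (w.1.adicCompletion L)) : Matrix (Fin 2) (Fin 2) (w.1.adicCompletion L)) + 1)⁻¹).det‖ ≤ (‖s‖ * ρ) ^ 2} with hB'_def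
  have hB' : ∀ u : ↥(unitaryGroupOfForm (galAdicCompletionMap (L := L) (IsCMField.complexConj L) hw) (placeForm (Matrix.of fun i j : Fin 2 => if i.val + j.val + 1 = 2 then (1 : L) else 0) w.1)), u ∈ B' ↔ IsUnit ((((u : ↥(unitaryGroupOfForm (galAdicCompletionMap (L := L) (IsCMField.complexConj L) hw) (placeForm (Matrix.of fun i j : Fin 2 => if i.val + j.val + 1 = 2 then (1 : L) else 0) w.1))) : GL (Fin 2) (w.1.adicCompletion L)) : Matrix (Fin 2) (Fin 2) (w.1.adicCompletion L)) + 1).det ∧ ‖(((((u : ↥(unitaryGroupOfForm (galAdicCompletionMap (L := L) (IsCMField.complexConj L) hw) (placeForm (Matrix.of fun i j : Fin 2 => if i.val + j.val + 1 = 2 then (1 : L) else 0) w.1))) : GL (Fin 2) (w.1.adicCompletion L)) : Matrix (Fin 2) (Fin 2) (w.1.adicCompletion L)) - 1) * ((((u : ↥(unitaryGroupOfForm (galAdicCompletionMap (L := L) (IsCMField.complexConj L) hw) (placeForm (Matrix.of fun i j : Fin 2 => if i.val + j.val + 1 = 2 then (1 : L) else 0) w.1))) : GL (Fin 2) (w.1.adicCompletion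 L)) : Matrix (Fin 2) (Fin 2) (w.1.adicCompletion L)) + 1)⁻¹).trace‖ ≤ ‖s‖ * ρ ∧ ‖(((((u : ↥(unitaryGroupOfForm (galAdicCompletionMap (L := L) (IsCMField.complexConj L) hw) (placeForm (Matrix.of fun i j : Fin 2 => if i.val + j.val + 1 = 2 then (1 : L) else 0) w.1))) : GL (Fin 2) (w.1.adicCompletion L)) : Matrix (Fin 2) (Fin 2) (w.1.adicCompletion L)) - 1) * ((((u : ↥(unitaryGroupOfForm (galAdicCompletionMap (L := L) (IsCMField.complexConj L) hw) (placeForm (Matrix.of fun i j : Fin 2 => if i.val + j.val + 1 = 2 then (1 : L) else 0) w.1))) : GL (Fin 2) (w.1.adicCompletion L)) : Matrix (Fin 2) (Fin 2) (w.1.adicCompletion L)) + 1)⁻¹).det‖ ≤ (‖s‖ * ρ) ^ 2 := fun u => Iff.rfl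
  obtain ⟨Ψ₀, hΨ₀⟩ := exists_cayleyScaling _ _ hB hσs hsρ
  obtain ⟨Θ, hΘ⟩ := exists_cayleyScaling _ _ hB' hσs' hsρ'
  -- ### the two arithmetic leaves
  have hEX := exists_galAdicCompletionMap_eq_and_ne_zero_and_not_isSquare L w hw
  have hCPT : ∀ γ : (UnitaryGroup.cmDatum L 2 (Matrix.of fun i j : Fin 2 => if i.val + j.val + 1 = 2 then (1 : L) else 0)).Local v, Irreducible (((γ.val : GL (Fin 2) (UnitaryGroup.LocalRing L v)).val).charpoly) →
      CompactSpace ↥(Subgroup.centralizer ({γ} : Set ((UnitaryGroup.cmDatum L 2 (Matrix.of fun i j : Fin 2 => if i.val + j.val + 1 = 2 then (1 : L) else 0)).Local v))) := fun γ hirr => compactSpace_centralizer_of_irreducible_charpoly L hsub γ hirr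
  -- ### the package
  refine ⟨fun γ => e.symm (Ψ₀ (e γ)), {γ | e γ ∈ B}, q, a, ?_, ?_, ?_, ?_, ?_, ?_, ?_, ?_, ?_, ?_, hq, ha, ?_, ?_⟩
  · -- (U1)
    have h1 : B ∈ 𝓝 (e ((1 : (UnitaryGroup.cmDatum L 2 (Matrix.of fun i j : Fin 2 => if i.val + j.val + 1 = 2 then (1 : L) else 0)).Local v))) := by rw [heone]; exact (one_mem_ball_nhds _ _ hB hρ0 hρ1 h2).2
    exact e.continuous.continuousAt h1
  · -- (U2)
    intro γ hγ x
    show e (x * γ * x⁻¹) ∈ B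
    rw [hemul, hemul, heinv]
    exact (conj_mem_ball_iff _ _ hB (e γ) (e x)).2 hγ
  · -- (U2st)
    intro γ hγ δ hst
    exact mem_of_isLocalStablyConjH L w hw hB hγ δ hst
  · -- (E)
    intro γ hγ x
    apply e.injective
    rw [ContinuousMulEquiv.apply_symm_apply, hemul, hemul, heinv, hemul, hemul, heinv, ContinuousMulEquiv.apply_symm_apply]
    exact (cayleyScaling_conj_mem _ _ hB hΨ₀ hsρ hγ (e x)).2
  · -- (Z), pointwise
    intro γ hγ z
    have h := (centralizer_cayleyScaling_eq _ _ hB hΨ₀ h2 hs0 hsρ hγ).1 (e z)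
    constructor
    · intro hzγ
      apply e.injective
      rw [hemul, hemul, ContinuousMulEquiv.apply_symm_apply]
      exact h.1 (by rw [← hemul, ← hemul, hzγ])
    · intro hzΨ
      apply e.injective
      rw [hemul, hemul]
      refine h.2 ?_
      have := congrArg e hzΨ
      rwa [hemul, hemul, ContinuousMulEquiv.apply_symm_apply] at this
  · -- (Est)
    intro γ hγ δ _ hst
    exact isLocalStablyConjH_map_map L w hw hB hΨ₀ hsρ hγ hst
  · -- (I)
    intro γ hγ δ hδ h
    exact injOn_map L w hw hB hΨ₀ hB' h2 hs0 hsρ (fun u hu => (hΘ u hu).1) hγ hδ h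
  · -- (Sst)
    intro γ hγ η hst
    obtain ⟨δ, hδ, hst', hΨδ⟩ := exists_isLocalStablyConjH_map_eq L w hw hB hΨ₀ hB' hΘ h2 hs0 hsρ hρ1 hγ η hst
    exact ⟨δ, hδ, hst', hΨδ⟩
  · -- (C)
    intro γ hγ
    show e (e.symm (Ψ₀ (e γ))) ∈ B
    rw [ContinuousMulEquiv.apply_symm_apply]
    exact cayleyScaling_mem_of_ball _ _ hB hΨ₀ h2 hsρ (mul_le_of_le_one_left hρ0.le hs1.le) hB hγ
  · -- (S_H)
    intro F hF
    exact isLocSmooth_indicator_prod_comp_local L w hw hB hΨ₀ hB' hΘ h2 hs0 hs1.le hρ0 hρ1 hF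
  · -- (RAY¹)
    intro ζ hζ lam
    exact exists_ray_of_nonsquare_of_compact L w hw hB hΨ₀ hσs hs0 hs1 hρ0 hρ1 hEX hCPT ζ hζ lam
  · -- (SC₁)
    intro S mU hunip hadm u hu F hF
    refine hlaw (fun γ => e.symm (Ψ₀ (e γ))) {γ | e γ ∈ B} (fun γ => Iff.rfl) (fun γ hγ => ?_) S mU hunip hadm u hu F hF
    rw [ContinuousMulEquiv.apply_symm_apply]
    exact (hΨ₀ (e γ) hγ).1

end Summit.HodgeConjecture.HodgeConjecture.Cruxes.H413.K2E3RankOneUnipotentScalingPackageOne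

end
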